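import Literature.MathematicalPhysics.QuantumFieldTheory.Balaban1983to89.B6Ineq2134Diag
import Literature.MathematicalPhysics.QuantumFieldTheory.Balaban1983to89.B6InMajorantTransplant

/-!
# `Balaban1983to89.B6Ineq2134DiagIn` — T. Bałaban, *Propagators and renormalization transformations for lattice gauge theories. II*,
# Commun. Math. Phys. **96** (1984) 223–250 [Balaban1984PropagatorsII], (2.134) p. 247 for the DIAGONAL pairs `K_{□,□}G_□h_□` ((2.92) p. 239) —
# r03's `…B6Ineq2134Diag.diag_hasMajorant` RESTATED WITH THE INPUT-LOCALISED `G_□`-HYPOTHESIS of (2.133) («supp J ⊂ Δ(y′), y′ ∈ 𝔅 ∩ T_□»,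
# outputs ANYWHERE: `…B6InMajorantTransplant.InMajorant`) in place of the pair «LocalMajorant on the reach + OutLoc to the reach», which a member
# transplanted from a torus window cannot satisfy (r03 gen 20, finding F4: the window wraps)

statement-level skeleton of published theorems with citation tags; proofs where landed; nothing here is a claim about the Yang–Mills mass gap

PDF held: `paper:balaban1984-cmp96-propagators-rt-ii` (journal page = PDF page + 222): p. 247 [PDF 25] ((2.133): *"for x ∈ Δ(y), supp J ⊂ Δ(y′),
y, y′ ∈ 𝔅∩T_□"* — inputs localised, outputs on the whole torus `T_□`; (2.134)), p. 239 [PDF 17] ((2.92)), p. 238 [PDF 16] (the remarks: *"an estimate of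
the terms with the commutator … gives a factor O(M⁻¹)"*); read from the tree transcriptions in `…B6Ineq2134Diag` (r03 gen 5) and `…B6Eq291Generator` (p02).

CITATION HEADER (lean-in-tree rule) — WHAT IS REPRODUCED.  Phase-2 file of the `lit-balaban` typed skeleton (HOME `run/shared/lean/pub/lit-balaban/`), seat
**p38 gen 27**; B6 fold owner r03 gen 20's INTERFACE FINDING F4 (seat INBOX 2026-08-23T05:45Z/05:46:59Z/05:56:57Z: *"the pair hG : LocalMajorant blk (G c)
(T c) … + hGout : OutLoc blk (G c) (T c) is UNSATISFIABLE by any member G_□ transplanted from a torus window … Please confirm or tell me the weakest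
G-hypothesis your kOff/kDiag proofs actually consume"*; p38's answer 06:13Z: the input-localised, all-outputs, decaying bound); SKELETON rows **B6.Eq2.134**
× **B6.Eq2.133** × **B6.Eq2.92** (cells only; decls of record untouched: `…B6Ineq2134Diag.diag_hasMajorant`, `…B6Ineq2134OffDiag`).  THIS FILE = the same
four-line estimate with the G-hypothesis in the shape print uses ((2.133) with inputs in the block of `y′ ∈ 𝔅 ∩ T_□` and outputs anywhere on `T_□`):
* §1 `hasMajorant_of_inMajorant` (an input-localised majorant `K` of `T` over `S` and a right factor `|h| ≤ 1` supported over `S` give the GLOBAL majorant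
  `K` of `T·h` — the replacement of r03's `hasMajorant_of_local`, needing NO output localisation);
* §2 `commLine_hasMajorant_h`, `domLine_hasMajorant_h`: r03's commutator line (lines 2, 4 of (2.92)) and change-of-domain line (line 3) with the hypothesis
  **`hGh : HasMajorant blk (G_□·h_□) (C_G(L^{j″}η)²e^{−δ₂d})`** (all pairs) in place of «hG + hGout + h-data» — r03's proofs verbatim minus the indicator
  factors (which r03 bounded by `1`);
* §3 **`diag_hasMajorant_in`** / `diag_h2134_in`: r03's `diag_hasMajorant` / `diag_h2134` with `(hG, hGout)` replaced by
  **`hGin : InMajorant blk Gl S (fun y y′ => C_G·len y²·e^{−δ₂d(y,y′)})`** (line 1 through `InMajorant.localMajorant` and r03's `line1_hasMajorant`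
  unchanged; lines 2–4 through §1–§2); SAME conclusion, same explicit `θ_diag`.
THEOREMS ONLY (no `def`, no `def … : Prop`, no new hypothesis-shaped fact; the G-hypothesis is WEAKER-TO-STATE-honestly, not stronger: it is implied by
`hG + hGout + (h supported over S)` for box members and is what (2.133) prints); standard axioms.

HONEST SCOPE / DIVERGENCES. As `…B6Ineq2134Diag` (constants ours and crude; rate `½δ₂`; the inputs (2.133)/(2.88)/line-3 majorant displayed); the only
change is the localisation bookkeeping of `G_□`.  Nothing on d = 4 or the continuum; NOT summit progress.  Unit `lit-balaban-p38` (gen 27), 2026-08-23.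

v1.1 (p38 gen 27; owner r03 gen 21, seat INBOX 2026-08-23T06:31:35Z: *"YES please ALSO weaken hN and hPl to the pair In-over-T c + Out-over-T c … for
window-transplanted members the all-pairs decaying forms of NC/Pl are false at wrap pairs exactly like hG"*, and the unit split of the first-order pieces
`EC e * Gl c` ~ len², `cfC` ~ len⁻²): §4 `hasMajorant_comm_inout` (the commutator `Nh − hN` from an INPUT-localised and an OUTPUT-localised majorant of
`N` over the set carrying `supp h`: inputs off the set are killed by `h` on the right, and then the left `h` localises the output), `line1_hasMajorant₂`
(line 1 with the TWO-power split `|c_e| ≤ s₁/(M·len²)`, `E_eG_□ ~ C₁len²e^{−δ₂d}` — `#D + 1` copies of the `c₀`-mechanism),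
`commLine_hasMajorant_inout`, **`diag_hasMajorant_inout`** / `diag_h2134_inout` (G: `InMajorant`; N_k: In + Out; first order: two-power; all else and the
conclusion as `diag_hasMajorant_in`).
-/

namespace Literature.MathematicalPhysics.QuantumFieldTheory.Balaban1983to89.B6Ineq2134DiagIn

open B6RandomWalk B6Prop26Gluing Finset
open B6Ineq268 (LevelSep)
open B6Lemma21Repaired (Ineq263With)
open B6Ineq2134OffDiag (term_le sum_le)
open B6Ineq2134Diag (hasMajorant_comm term_comm_le line1_hasMajorant hasMajorant_sandwichW)
open B6InMajorantTransplant (InMajorant)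

variable {g : B6.Geometry} {X : Type}

/-! ## §1  An input-localised majorant and a supported right factor give a global majorant -/

section Carrier

/-- a left cut-off |z| ≤ 1 does not increase a majorant. [cite: Balaban1984PropagatorsII, (2.92) p.239 (ζ_□)] -/
private theorem hasMajorant_mulOp_left (blk : X → g.Site) {T : Module.End ℝ (X → ℝ)} {K : g.Site → g.Site → ℝ}
    (hT : HasMajorant blk T K) {z : X → ℝ} (hz : ∀ x, |z x| ≤ 1) : HasMajorant blk (mulOp z * T) K := by
  intro y' μ B hμ x
  rw [Module.End.mul_apply, mulOp_apply, abs_mul]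
  calc |z x| * |T μ x| ≤ 1 * |T μ x| := mul_le_mul_of_nonneg_right (hz x) (abs_nonneg _)
    _ = |T μ x| := one_mul _
    _ ≤ K (blk x) y' * B := hT y' μ B hμ x

/-- **`G_□h_□` AS A GLOBAL OPERATOR FROM (2.133) AS PRINTED**: an input-localised majorant `K ≥ 0` of `T` over `S` (*"supp J ⊂ Δ(y′), y′ ∈ 𝔅 ∩ T_□"*,
outputs anywhere) and a right factor `|h| ≤ 1` supported over `S` give the global majorant `K` of `T·h` (inputs off `S` are killed by `h`).
[cite: Balaban1984PropagatorsII, (2.133) p.247, (2.91) p.239] -/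
theorem hasMajorant_of_inMajorant (blk : X → g.Site) {T : Module.End ℝ (X → ℝ)} {h : X → ℝ} {S : Set g.Site}
    {K : g.Site → g.Site → ℝ} (hK : ∀ y y', 0 ≤ K y y') (hT : InMajorant blk T S K)
    (hsupp : ∀ x, h x ≠ 0 → blk x ∈ S) (hle : ∀ x, |h x| ≤ 1) :
    HasMajorant blk (T * mulOp h) K := by
  intro y' μ B hμ x
  rw [Module.End.mul_apply]
  by_cases hy : y' ∈ S
  · exact hT y' hy (mulOp h μ) B (blockSupp_mulOp blk hle hμ) x
  · rw [mulOp_eq_zero_of_blockSupp blk hsupp hμ hy, map_zero, Pi.zero_apply, abs_zero]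
    exact mul_nonneg (hK _ _) hμ.nonneg

end Carrier

/-! ## §2  Lines 2–4 of (2.92) against the global majorant of `G_□h_□` -/

section Lines

/-- **A COMMUTATOR LINE OF (2.92) IN (2.134)** (r03's `commLine_hasMajorant`) with the hypothesis `hGh`: the GLOBAL majorant `C_G(L^{j″}η)²e^{−δ₂d}` of
`G_□h_□` (all pairs) in place of «local majorant + output localisation + h-data»: `z·(Nh_□ − h_□N)·(G_□h_□)` has the majorant
`(s/M)·C_N·C_G·L²·(8/δ₂ + r₀)·c²·e^{−½δ₂d(y,y′)}`. [cite: Balaban1984PropagatorsII, (2.134) p.247 + (2.92) p.239 + p.238] -/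
theorem commLine_hasMajorant_h (blk : X → g.Site) (hL : 1 ≤ g.L) (hη : 0 < g.eta) (hsep : LevelSep g)
    (hd : ∀ a b, 0 ≤ g.dist a b) {δ₂ CN CG c s r₀ : ℝ} (hδ₂ : 0 < δ₂) (hCN : 0 ≤ CN) (hCG : 0 ≤ CG)
    (hs : 0 ≤ s) (hr₀ : 0 ≤ r₀) (hM : 0 < g.M) (hRM : 0 ≤ g.R * g.M)
    (hthr : g.L ^ 2 ≤ Real.exp (1 / 8 * δ₂ * (g.R * g.M))) (h263 : Ineq263With c g (3 / 4 * δ₂) (1 / 3))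
    {N GH : Module.End ℝ (X → ℝ)} {z hc : X → ℝ}
    (hN : HasMajorant blk N fun y y'' => CN / g.len y ^ 2 * Real.exp (-(δ₂ * g.dist y y'')))
    (hz : ∀ x, |z x| ≤ 1) (hLip : ∀ x x', |hc x' - hc x| ≤ s / g.M * (g.dist (blk x) (blk x') + r₀))
    (hGh : HasMajorant blk GH fun y'' y' => CG * g.len y'' ^ 2 * Real.exp (-(δ₂ * g.dist y'' y'))) :
    HasMajorant blk (mulOp z * (N * mulOp hc - mulOp hc * N) * GH) fun y y' =>
      s / g.M * (CN * CG * g.L ^ 2 * (8 / δ₂ + r₀)) * c ^ 2 * Real.exp (-(1 / 2 * δ₂ * g.dist y y')) := by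
  classical
  have hL0 : 0 < g.L := zero_lt_one.trans_le hL
  have hlen : ∀ z : g.Site, 0 < g.len z := fun z => mul_pos (pow_pos hL0 _) hη
  -- (1) the commutator with the block-Lipschitz h_□
  have hlipnn : ∀ y y'' : g.Site, 0 ≤ s / g.M * (g.dist y y'' + r₀) := fun y y'' => by
    have := hd y y''
    positivity
  have hcomm := hasMajorant_comm blk hN (lip := fun y y'' => s / g.M * (g.dist y y'' + r₀)) hlipnn hLip
  -- (2) composition and the cut-off
  have hKG : ∀ a b : g.Site, 0 ≤ CG * g.len a ^ 2 * Real.exp (-(δ₂ * g.dist a b)) := fun a b => by positivity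
  have hmul := hasMajorant_mul blk hcomm hGh hKG
  have hzT := hasMajorant_mulOp_left blk hmul hz
  rw [mul_assoc (mulOp z)]
  refine hasMajorant_mono blk hzT fun y y' => ?_
  -- (3) the pointwise bound
  have hterm : ∀ y'' : g.Site,
      s / g.M * (g.dist y y'' + r₀) * (CN / g.len y ^ 2 * Real.exp (-(δ₂ * g.dist y y''))) *
        (CG * g.len y'' ^ 2 * Real.exp (-(δ₂ * g.dist y'' y'))) ≤
      s / g.M * (CN * CG * g.L ^ 2 * (8 / δ₂ + r₀)) *
        (Real.exp (-(3 / 4 * δ₂ * g.dist y y'')) * Real.exp (-(3 / 4 * δ₂ * g.dist y'' y'))) :=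
    fun y'' => term_comm_le hL hη hsep hd hδ₂ hCN hCG hs hr₀ hM hRM hthr y y'' y'
  have hKnn : 0 ≤ s / g.M * (CN * CG * g.L ^ 2 * (8 / δ₂ + r₀)) := by positivity
  calc ∑ y'' : g.Site, s / g.M * (g.dist y y'' + r₀) * (CN / g.len y ^ 2 * Real.exp (-(δ₂ * g.dist y y''))) *
          (CG * g.len y'' ^ 2 * Real.exp (-(δ₂ * g.dist y'' y')))
      ≤ ∑ y'' : g.Site, s / g.M * (CN * CG * g.L ^ 2 * (8 / δ₂ + r₀)) *
          (Real.exp (-(3 / 4 * δ₂ * g.dist y y'')) * Real.exp (-(3 / 4 * δ₂ * g.dist y'' y'))) :=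
        Finset.sum_le_sum fun y'' _ => hterm y''
    _ = s / g.M * (CN * CG * g.L ^ 2 * (8 / δ₂ + r₀)) *
          ∑ y'' : g.Site, Real.exp (-(3 / 4 * δ₂ * g.dist y y'')) * Real.exp (-(3 / 4 * δ₂ * g.dist y'' y')) := by
        rw [Finset.mul_sum]
    _ ≤ s / g.M * (CN * CG * g.L ^ 2 * (8 / δ₂ + r₀)) * (c ^ 2 * Real.exp (-(1 / 2 * δ₂ * g.dist y y'))) :=
        mul_le_mul_of_nonneg_left (sum_le h263 y y') hKnn
    _ = _ := by ring

/-- **LINE 3 OF (2.92) IN (2.134)** (r03's `domLine_hasMajorant`) with the hypothesis `hGh`: `D₃·(G_□h_□)` has the majorant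
`C_De^{−c_DM}·C_G·L²·c²·e^{−½δ₂d(y,y′)}`. [cite: Balaban1984PropagatorsII, (2.134) p.247 + (2.92) p.239 + p.238] -/
theorem domLine_hasMajorant_h (blk : X → g.Site) (hL : 1 ≤ g.L) (hη : 0 < g.eta) (hsep : LevelSep g)
    (hd : ∀ a b, 0 ≤ g.dist a b) {δ₂ CD cD CG c : ℝ} (hδ₂ : 0 ≤ δ₂) (hCD : 0 ≤ CD) (hCG : 0 ≤ CG)
    (hRM : 0 ≤ g.R * g.M) (hthr : g.L ^ 2 ≤ Real.exp (1 / 8 * δ₂ * (g.R * g.M)))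
    (h263 : Ineq263With c g (3 / 4 * δ₂) (1 / 3))
    {D₃ GH : Module.End ℝ (X → ℝ)}
    (hD : HasMajorant blk D₃ fun y y'' => CD * Real.exp (-(cD * g.M)) / g.len y ^ 2 * Real.exp (-(δ₂ * g.dist y y'')))
    (hGh : HasMajorant blk GH fun y'' y' => CG * g.len y'' ^ 2 * Real.exp (-(δ₂ * g.dist y'' y'))) :
    HasMajorant blk (D₃ * GH) fun y y' =>
      CD * Real.exp (-(cD * g.M)) * CG * g.L ^ 2 * c ^ 2 * Real.exp (-(1 / 2 * δ₂ * g.dist y y')) := by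
  classical
  have hL0 : 0 < g.L := zero_lt_one.trans_le hL
  have hlen : ∀ z : g.Site, 0 < g.len z := fun z => mul_pos (pow_pos hL0 _) hη
  have hCP : 0 ≤ CD * Real.exp (-(cD * g.M)) := mul_nonneg hCD (Real.exp_nonneg _)
  have hKG : ∀ a b : g.Site, 0 ≤ CG * g.len a ^ 2 * Real.exp (-(δ₂ * g.dist a b)) := fun a b => by positivity
  have hmul := hasMajorant_mul blk hD hGh hKG
  refine hasMajorant_mono blk hmul fun y y' => ?_
  have hterm : ∀ y'' : g.Site,
      CD * Real.exp (-(cD * g.M)) / g.len y ^ 2 * Real.exp (-(δ₂ * g.dist y y'')) *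
        (CG * g.len y'' ^ 2 * Real.exp (-(δ₂ * g.dist y'' y'))) ≤
      CD * Real.exp (-(cD * g.M)) * CG * g.L ^ 2 *
        (Real.exp (-(3 / 4 * δ₂ * g.dist y y'')) * Real.exp (-(3 / 4 * δ₂ * g.dist y'' y'))) := by
    intro y''
    have hgap : (0 : ℝ) * g.M ≤ g.dist y y'' := by rw [zero_mul]; exact hd y y''
    have ht := term_le hL hη hsep hd hδ₂ hCP hCG hRM hthr y' hgap
    have e0 : Real.exp (-(1 / 8 * δ₂ * (0 * g.M))) = 1 := by simp
    rw [e0, mul_one] at ht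
    exact ht
  have hKnn : 0 ≤ CD * Real.exp (-(cD * g.M)) * CG * g.L ^ 2 := by positivity
  calc ∑ y'' : g.Site, CD * Real.exp (-(cD * g.M)) / g.len y ^ 2 * Real.exp (-(δ₂ * g.dist y y'')) *
          (CG * g.len y'' ^ 2 * Real.exp (-(δ₂ * g.dist y'' y')))
      ≤ ∑ y'' : g.Site, CD * Real.exp (-(cD * g.M)) * CG * g.L ^ 2 *
          (Real.exp (-(3 / 4 * δ₂ * g.dist y y'')) * Real.exp (-(3 / 4 * δ₂ * g.dist y'' y'))) :=
        Finset.sum_le_sum fun y'' _ => hterm y''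
    _ = CD * Real.exp (-(cD * g.M)) * CG * g.L ^ 2 *
          ∑ y'' : g.Site, Real.exp (-(3 / 4 * δ₂ * g.dist y y'')) * Real.exp (-(3 / 4 * δ₂ * g.dist y'' y')) := by
        rw [Finset.mul_sum]
    _ ≤ CD * Real.exp (-(cD * g.M)) * CG * g.L ^ 2 * (c ^ 2 * Real.exp (-(1 / 2 * δ₂ * g.dist y y'))) :=
        mul_le_mul_of_nonneg_left (sum_le h263 y y') hKnn
    _ = _ := by ring

end Lines

/-! ## §3  (2.134) for the diagonal pairs with the input-localised `G_□` -/

section Diagonal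

/-- **(2.134), DIAGONAL PAIRS □ = □′, WITH `G_□` INPUT-LOCALISED AS IN (2.133)** (r03's `diag_hasMajorant` with `(hG, hGout)` replaced by
`hGin : InMajorant blk Gl S (C_G·len²·e^{−δ₂d})` — inputs over the reach `S`, outputs anywhere): `(line 1 + lines 2,4 + line 3)·(G_□h_□)` has the majorant
`θ_diag·e^{−½δ₂d}`, `θ_diag = (#D·s₁C₁ + s₂C_G)/M + #K·(s/M)·C_NC_GL²(8/δ₂ + r₀)c² + C_De^{−c_DM}C_GL²c²` (r03's `theta_diag_le`: `= O(M⁻¹)`).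
[cite: Balaban1984PropagatorsII, (2.134) p.247 + (2.133) p.247 + (2.92) p.239] -/
theorem diag_hasMajorant_in (blk : X → g.Site) (hL : 1 ≤ g.L) (hη : 0 < g.eta) (hsep : LevelSep g)
    (hd : ∀ a b, 0 ≤ g.dist a b) {δ₂ CG C₁ CN CD cD c s s₁ s₂ r₀ : ℝ} (hδ₂ : 0 < δ₂) (hCG : 0 ≤ CG)
    (hC₁ : 0 ≤ C₁) (hCN : 0 ≤ CN) (hCD : 0 ≤ CD) (hs : 0 ≤ s) (hs₁ : 0 ≤ s₁) (hs₂ : 0 ≤ s₂) (hr₀ : 0 ≤ r₀)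
    (hM : 0 < g.M) (hRM : 0 ≤ g.R * g.M) (hthr : g.L ^ 2 ≤ Real.exp (1 / 8 * δ₂ * (g.R * g.M)))
    (h263 : Ineq263With c g (3 / 4 * δ₂) (1 / 3))
    {Gl D₃ : Module.End ℝ (X → ℝ)} {hI c₀ : X → ℝ} {S : Set g.Site}
    {ι : Type} (D : Finset ι) {E : ι → Module.End ℝ (X → ℝ)} {cf : ι → X → ℝ}
    {κ : Type} (DK : Finset κ) {N : κ → Module.End ℝ (X → ℝ)} {z : κ → X → ℝ}
    (hGin : InMajorant blk Gl S fun y y' => CG * g.len y ^ 2 * Real.exp (-(δ₂ * g.dist y y')))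
    (hEG : ∀ i ∈ D, LocalMajorant blk (E i * Gl) S fun y y' => C₁ * g.len y * Real.exp (-(δ₂ * g.dist y y')))
    (hc : ∀ i ∈ D, ∀ x, |cf i x| ≤ s₁ / (g.M * g.len (blk x))) (hcS : ∀ i ∈ D, ∀ x, cf i x ≠ 0 → blk x ∈ S)
    (hc₀ : ∀ x, |c₀ x| ≤ s₂ / (g.M * g.len (blk x) ^ 2)) (hc₀S : ∀ x, c₀ x ≠ 0 → blk x ∈ S)
    (hI1 : ∀ x, |hI x| ≤ 1) (hIS : ∀ x, hI x ≠ 0 → blk x ∈ S)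
    (hLip : ∀ x x', |hI x' - hI x| ≤ s / g.M * (g.dist (blk x) (blk x') + r₀))
    (hN : ∀ k ∈ DK, HasMajorant blk (N k) fun y y'' => CN / g.len y ^ 2 * Real.exp (-(δ₂ * g.dist y y'')))
    (hz : ∀ k ∈ DK, ∀ x, |z k x| ≤ 1)
    (hD : HasMajorant blk D₃ fun y y'' => CD * Real.exp (-(cD * g.M)) / g.len y ^ 2 * Real.exp (-(δ₂ * g.dist y y''))) :
    HasMajorant blk
      (((∑ i ∈ D, mulOp (cf i) * E i - mulOp c₀) + (∑ k ∈ DK, mulOp (z k) * (N k * mulOp hI - mulOp hI * N k)) + D₃) *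
        (Gl * mulOp hI))
      fun y y' =>
        ((D.card * (s₁ * C₁) + s₂ * CG) / g.M + DK.card * (s / g.M * (CN * CG * g.L ^ 2 * (8 / δ₂ + r₀)) * c ^ 2) +
            CD * Real.exp (-(cD * g.M)) * CG * g.L ^ 2 * c ^ 2) *
          Real.exp (-(1 / 2 * δ₂ * g.dist y y')) := by
  classical
  have hL0 : 0 < g.L := zero_lt_one.trans_le hL
  -- `G_□h_□` globally, from the input-localised (2.133)
  have hKG : ∀ a b : g.Site, 0 ≤ CG * g.len a ^ 2 * Real.exp (-(δ₂ * g.dist a b)) := fun a b => by positivity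
  have hGh := hasMajorant_of_inMajorant blk hKG hGin hIS hI1
  rw [add_mul, add_mul, Finset.sum_mul]
  -- line 1 (central outputs only: r03's lemma with the local majorant on the reach)
  have h1 := line1_hasMajorant blk hL0 hη hM (δ₂ := δ₂) hCG hC₁ hs₁ hs₂ D hGin.localMajorant hEG hc hcS hc₀ hc₀S hI1 hIS
  -- lines 2, 4
  have h2 := hasMajorant_finsetSum blk DK (fun k => mulOp (z k) * (N k * mulOp hI - mulOp hI * N k) * (Gl * mulOp hI))
    (fun _ y y' => s / g.M * (CN * CG * g.L ^ 2 * (8 / δ₂ + r₀)) * c ^ 2 * Real.exp (-(1 / 2 * δ₂ * g.dist y y')))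
    fun k hk => commLine_hasMajorant_h blk hL hη hsep hd hδ₂ hCN hCG hs hr₀ hM hRM hthr h263 (hN k hk) (hz k hk) hLip hGh
  -- line 3
  have h3 := domLine_hasMajorant_h blk hL hη hsep hd hδ₂.le hCD hCG hRM hthr h263 hD hGh
  refine hasMajorant_mono blk (hasMajorant_add blk (hasMajorant_add blk h1 h2) h3) fun y y' => ?_
  -- pointwise: the rate δ₂ of line 1 is at least ½δ₂; the commutator lines add up
  have hθ₁ : 0 ≤ (D.card * (s₁ * C₁) + s₂ * CG) / g.M := by positivity
  have hrate : Real.exp (-(δ₂ * g.dist y y')) ≤ Real.exp (-(1 / 2 * δ₂ * g.dist y y')) := by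
    apply Real.exp_le_exp.mpr
    have := hd y y'
    nlinarith
  have hl1 : (D.card * (s₁ * C₁) + s₂ * CG) / g.M * Real.exp (-(δ₂ * g.dist y y')) ≤
      (D.card * (s₁ * C₁) + s₂ * CG) / g.M * Real.exp (-(1 / 2 * δ₂ * g.dist y y')) :=
    mul_le_mul_of_nonneg_left hrate hθ₁
  rw [Finset.sum_const, nsmul_eq_mul]
  nlinarith [hl1]

/-- **(2.134) for □ = □′ with the input-localised `G_□`, in the hypothesis shape of `…B6Prop26Gluing.majorant_R_of_2134`** (`(Kt·G_□)·h_□`).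
[cite: Balaban1984PropagatorsII, (2.134) p.247, (2.133) p.247] -/
theorem diag_h2134_in (blk : X → g.Site) (hL : 1 ≤ g.L) (hη : 0 < g.eta) (hsep : LevelSep g)
    (hd : ∀ a b, 0 ≤ g.dist a b) {δ₂ CG C₁ CN CD cD c s s₁ s₂ r₀ : ℝ} (hδ₂ : 0 < δ₂) (hCG : 0 ≤ CG)
    (hC₁ : 0 ≤ C₁) (hCN : 0 ≤ CN) (hCD : 0 ≤ CD) (hs : 0 ≤ s) (hs₁ : 0 ≤ s₁) (hs₂ : 0 ≤ s₂) (hr₀ : 0 ≤ r₀)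
    (hM : 0 < g.M) (hRM : 0 ≤ g.R * g.M) (hthr : g.L ^ 2 ≤ Real.exp (1 / 8 * δ₂ * (g.R * g.M)))
    (h263 : Ineq263With c g (3 / 4 * δ₂) (1 / 3))
    {Gl D₃ : Module.End ℝ (X → ℝ)} {hI c₀ : X → ℝ} {S : Set g.Site}
    {ι : Type} (D : Finset ι) {E : ι → Module.End ℝ (X → ℝ)} {cf : ι → X → ℝ}
    {κ : Type} (DK : Finset κ) {N : κ → Module.End ℝ (X → ℝ)} {z : κ → X → ℝ}
    (hGin : InMajorant blk Gl S fun y y' => CG * g.len y ^ 2 * Real.exp (-(δ₂ * g.dist y y')))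
    (hEG : ∀ i ∈ D, LocalMajorant blk (E i * Gl) S fun y y' => C₁ * g.len y * Real.exp (-(δ₂ * g.dist y y')))
    (hc : ∀ i ∈ D, ∀ x, |cf i x| ≤ s₁ / (g.M * g.len (blk x))) (hcS : ∀ i ∈ D, ∀ x, cf i x ≠ 0 → blk x ∈ S)
    (hc₀ : ∀ x, |c₀ x| ≤ s₂ / (g.M * g.len (blk x) ^ 2)) (hc₀S : ∀ x, c₀ x ≠ 0 → blk x ∈ S)
    (hI1 : ∀ x, |hI x| ≤ 1) (hIS : ∀ x, hI x ≠ 0 → blk x ∈ S)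
    (hLip : ∀ x x', |hI x' - hI x| ≤ s / g.M * (g.dist (blk x) (blk x') + r₀))
    (hN : ∀ k ∈ DK, HasMajorant blk (N k) fun y y'' => CN / g.len y ^ 2 * Real.exp (-(δ₂ * g.dist y y'')))
    (hz : ∀ k ∈ DK, ∀ x, |z k x| ≤ 1)
    (hD : HasMajorant blk D₃ fun y y'' => CD * Real.exp (-(cD * g.M)) / g.len y ^ 2 * Real.exp (-(δ₂ * g.dist y y''))) :
    HasMajorant blk
      (((∑ i ∈ D, mulOp (cf i) * E i - mulOp c₀) + (∑ k ∈ DK, mulOp (z k) * (N k * mulOp hI - mulOp hI * N k)) + D₃) *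
          Gl * mulOp hI)
      fun y y' =>
        ((D.card * (s₁ * C₁) + s₂ * CG) / g.M + DK.card * (s / g.M * (CN * CG * g.L ^ 2 * (8 / δ₂ + r₀)) * c ^ 2) +
            CD * Real.exp (-(cD * g.M)) * CG * g.L ^ 2 * c ^ 2) *
          Real.exp (-(1 / 2 * δ₂ * g.dist y y')) := by
  rw [mul_assoc]
  exact diag_hasMajorant_in blk hL hη hsep hd hδ₂ hCG hC₁ hCN hCD hs hs₁ hs₂ hr₀ hM hRM hthr h263 D DK hGin hEG hc hcS
    hc₀ hc₀S hI1 hIS hLip hN hz hD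

end Diagonal

/-! ## §4  v1.1: the partners `N_k` input/output-localised, line 1 with the two-power split -/

section InOut

/-- majorants pass to `−T`. [folklore] -/
private theorem hasMajorant_neg' (blk : X → g.Site) {T : Module.End ℝ (X → ℝ)} {K : g.Site → g.Site → ℝ}
    (hT : HasMajorant blk T K) : HasMajorant blk (-T) K := by
  intro y' μ B hμ x
  rw [LinearMap.neg_apply, Pi.neg_apply, abs_neg]
  exact hT y' μ B hμ x

/-- **THE COMMUTATOR WITH A BLOCK-LIPSCHITZ FUNCTION FROM LOCALISED MAJORANTS OF `N`** (the partners `Q*a_□Q`, `∂P_□∂*` of a window member): if `N` has the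
majorant `K_N ≥ 0` for INPUTS over `T` (outputs anywhere) and for OUTPUTS over `T` (inputs anywhere), `h` is supported over `T` and `|h(x′) − h(x)| ≤ lip(y,y′)`,
then `Nh − hN` has the majorant `lip·K_N` for ALL pairs: an input block off `T` carries `h ≡ 0`, so there `(Nh − hN)μ = −h·(Nμ)` lives on outputs over `T`
and `|h(x)| = |h(x) − h(x′)| ≤ lip`. [cite: Balaban1984PropagatorsII, (2.92) p.239 (lines 2, 4), (2.133) p.247] -/
theorem hasMajorant_comm_inout (blk : X → g.Site) {N : Module.End ℝ (X → ℝ)} {KN : g.Site → g.Site → ℝ} {T : Set g.Site}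
    (hKN : ∀ y y', 0 ≤ KN y y') (hNin : InMajorant blk N T KN)
    (hNout : ∀ (y' : g.Site) (μ : X → ℝ) (B : ℝ), BlockSupp blk μ y' B → ∀ x, blk x ∈ T → |N μ x| ≤ KN (blk x) y' * B)
    {h : X → ℝ} (hsupp : ∀ x, h x ≠ 0 → blk x ∈ T) {lip : g.Site → g.Site → ℝ} (hlip : ∀ y y', 0 ≤ lip y y')
    (hLip : ∀ x x', |h x' - h x| ≤ lip (blk x) (blk x')) :
    HasMajorant blk (N * mulOp h - mulOp h * N) (fun y y' => lip y y' * KN y y') := by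
  intro y' μ B hμ x
  beta_reduce
  have hnn : 0 ≤ lip (blk x) y' * KN (blk x) y' * B := mul_nonneg (mul_nonneg (hlip _ _) (hKN _ _)) hμ.nonneg
  -- the function (h − h(x))μ, supported in the block of y′ with bound lip(y,y′)·B
  set ν : X → ℝ := fun x' => (h x' - h x) * μ x' with hν
  have hνsupp : BlockSupp blk ν y' (lip (blk x) y' * B) := by
    refine ⟨mul_nonneg (hlip _ _) hμ.nonneg, fun x' hx' => ?_, fun x' hx' => ?_⟩
    · rw [hν]
      dsimp only
      rw [abs_mul]
      have h1 : |h x' - h x| ≤ lip (blk x) y' := by rw [← hx']; exact hLip x x'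
      exact mul_le_mul h1 (hμ.bound x' hx') (abs_nonneg _) (hlip _ _)
    · rw [hν]
      dsimp only
      rw [hμ.off x' hx', mul_zero]
  have hνeq : ν = mulOp h μ - h x • μ := by
    funext x'
    simp only [hν, Pi.sub_apply, mulOp_apply, Pi.smul_apply, smul_eq_mul]
    ring
  have hid : (N * mulOp h - mulOp h * N) μ x = N ν x := by
    rw [hνeq, map_sub, map_smul, LinearMap.sub_apply, Module.End.mul_apply, Module.End.mul_apply, Pi.sub_apply,
      mulOp_apply, Pi.sub_apply, Pi.smul_apply, smul_eq_mul]
  rw [hid]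
  by_cases hy : y' ∈ T
  · -- input block over `T`: the input-localised majorant
    calc |N ν x| ≤ KN (blk x) y' * (lip (blk x) y' * B) := hNin y' hy ν _ hνsupp x
      _ = lip (blk x) y' * KN (blk x) y' * B := by ring
  · -- input block off `T`: `h ≡ 0` there, `ν = −h(x)·μ`, and the output is localised by `h(x)`
    have hzero : ∀ x', blk x' = y' → h x' = 0 := fun x' hx' => by
      by_contra hne
      exact hy (hx' ▸ hsupp x' hne)
    have hν' : ν = (-(h x)) • μ := by
      funext x'
      simp only [hν, Pi.smul_apply, smul_eq_mul]
      by_cases hx' : blk x' = y'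
      · rw [hzero x' hx']; ring
      · rw [hμ.off x' hx']; ring
    rw [hν', map_smul, Pi.smul_apply, smul_eq_mul, abs_mul, abs_neg]
    by_cases hxT : blk x ∈ T
    · by_cases hex : ∃ x', blk x' = y'
      · obtain ⟨x', hx'⟩ := hex
        have h1 : |h x| ≤ lip (blk x) y' := by
          have := hLip x x'
          rw [hzero x' hx', zero_sub, abs_neg] at this
          rw [← hx']; exact this
        calc |h x| * |N μ x| ≤ lip (blk x) y' * (KN (blk x) y' * B) :=
              mul_le_mul h1 (hNout y' μ B hμ x hxT) (abs_nonneg _) (hlip _ _)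
          _ = lip (blk x) y' * KN (blk x) y' * B := by ring
      · have hμ0 : μ = 0 := by
          funext x'
          exact hμ.off x' (fun hx' => hex ⟨x', hx'⟩)
        rw [hμ0, map_zero, Pi.zero_apply, abs_zero, mul_zero]
        exact hnn
    · have h0 : h x = 0 := by
        by_contra hne
        exact hxT (hsupp x hne)
      rw [h0, abs_zero, zero_mul]
      exact hnn

/-- **LINE 1 OF (2.92) IN (2.134) WITH THE TWO-POWER SPLIT**: first-order pieces `E_i∘G_□` under the LOCAL majorant `C₁·(L^jη)²·e^{−δ₂d}` and coefficients
`|c_i| ≤ s₁/(M·(L^jη)²)` (the split carried by a member's `E_e·G_□` read through the unit `(c′/L^j)²` — r03's `EC e * Gl c` — and p38's `cfC`), `G_□` LOCAL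
`C_G(L^jη)²e^{−δ₂d}`, `|c₀| ≤ s₂/(M(L^jη)²)`: `(Σ_i c_iE_i − c₀)·G_□·h_□` has the majorant `((#D·s₁C₁ + s₂C_G)/M)·e^{−δ₂d}` — `#D + 1` copies of the
`c₀`-mechanism of r03's `line1_hasMajorant`. [cite: Balaban1984PropagatorsII, (2.134) p.247 + (2.92) p.239] -/
theorem line1_hasMajorant₂ (blk : X → g.Site) (hL : 0 < g.L) (hη : 0 < g.eta) (hM : 0 < g.M)
    {δ₂ CG C₁ s₁ s₂ : ℝ} (hCG : 0 ≤ CG) (hC₁ : 0 ≤ C₁) (hs₁ : 0 ≤ s₁) (hs₂ : 0 ≤ s₂)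
    {ι : Type} (D : Finset ι) {E : ι → Module.End ℝ (X → ℝ)} {c : ι → X → ℝ} {c₀ hI : X → ℝ}
    {Gl : Module.End ℝ (X → ℝ)} {S : Set g.Site}
    (hG : LocalMajorant blk Gl S fun y y' => CG * g.len y ^ 2 * Real.exp (-(δ₂ * g.dist y y')))
    (hEG : ∀ i ∈ D, LocalMajorant blk (E i * Gl) S fun y y' => C₁ * g.len y ^ 2 * Real.exp (-(δ₂ * g.dist y y')))
    (hc : ∀ i ∈ D, ∀ x, |c i x| ≤ s₁ / (g.M * g.len (blk x) ^ 2)) (hcS : ∀ i ∈ D, ∀ x, c i x ≠ 0 → blk x ∈ S)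
    (hc₀ : ∀ x, |c₀ x| ≤ s₂ / (g.M * g.len (blk x) ^ 2)) (hc₀S : ∀ x, c₀ x ≠ 0 → blk x ∈ S)
    (hI1 : ∀ x, |hI x| ≤ 1) (hIS : ∀ x, hI x ≠ 0 → blk x ∈ S) :
    HasMajorant blk ((∑ i ∈ D, mulOp (c i) * E i - mulOp c₀) * (Gl * mulOp hI)) fun y y' =>
      (D.card * (s₁ * C₁) + s₂ * CG) / g.M * Real.exp (-(δ₂ * g.dist y y')) := by
  classical
  have hlen : ∀ z : g.Site, 0 < g.len z := fun z => mul_pos (pow_pos hL _) hη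
  -- distribute the right factor G_□h_□ over the first-order sum
  have e : (∑ i ∈ D, mulOp (c i) * E i - mulOp c₀) * (Gl * mulOp hI) =
      ∑ i ∈ D, mulOp (c i) * (E i * Gl) * mulOp hI + -(mulOp c₀ * Gl * mulOp hI) := by
    rw [sub_mul, Finset.sum_mul]
    simp only [mul_assoc, sub_eq_add_neg]
  rw [e]
  -- every term is a `c₀`-type sandwich
  have hK : ∀ (C : ℝ), 0 ≤ C → ∀ y y' : g.Site, 0 ≤ C * g.len y ^ 2 * Real.exp (-(δ₂ * g.dist y y')) :=
    fun C hC y y' => by positivity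
  have hα : ∀ (s : ℝ), 0 ≤ s → ∀ y : g.Site, 0 ≤ s / (g.M * g.len y ^ 2) := fun s hs y => by
    have := hlen y
    positivity
  have hterm : ∀ i ∈ D, HasMajorant blk (mulOp (c i) * (E i * Gl) * mulOp hI) fun y y' =>
      ind S y * ind S y' * (s₁ / (g.M * g.len y ^ 2) * (C₁ * g.len y ^ 2 * Real.exp (-(δ₂ * g.dist y y')))) :=
    fun i hi => hasMajorant_sandwichW blk (hK C₁ hC₁) (hα s₁ hs₁) (hcS i hi) (hc i hi) hIS hI1 (hEG i hi)
  have hsum := hasMajorant_finsetSum blk D _ _ hterm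
  have h0 : HasMajorant blk (mulOp c₀ * Gl * mulOp hI) fun y y' =>
      ind S y * ind S y' * (s₂ / (g.M * g.len y ^ 2) * (CG * g.len y ^ 2 * Real.exp (-(δ₂ * g.dist y y')))) :=
    hasMajorant_sandwichW blk (hK CG hCG) (hα s₂ hs₂) hc₀S hc₀ hIS hI1 hG
  have hall := hasMajorant_add blk hsum (hasMajorant_neg' blk h0)
  refine hasMajorant_mono blk hall fun y y' => ?_
  -- pointwise: the lengths cancel
  have hy : g.len y ≠ 0 := (hlen y).ne'
  have hMne : g.M ≠ 0 := hM.ne'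
  have hii : ind S y * ind S y' ≤ 1 :=
    (mul_le_mul (ind_le_one _ _) (ind_le_one _ _) (ind_nonneg _ _) zero_le_one).trans_eq (one_mul 1)
  have ecan : ∀ s C : ℝ, s / (g.M * g.len y ^ 2) * (C * g.len y ^ 2 * Real.exp (-(δ₂ * g.dist y y'))) =
      s * C / g.M * Real.exp (-(δ₂ * g.dist y y')) := fun s C => by field_simp
  have hle : ∀ s C : ℝ, 0 ≤ s → 0 ≤ C →
      ind S y * ind S y' * (s / (g.M * g.len y ^ 2) * (C * g.len y ^ 2 * Real.exp (-(δ₂ * g.dist y y')))) ≤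
        s * C / g.M * Real.exp (-(δ₂ * g.dist y y')) := by
    intro s C hs hC
    rw [ecan]
    have hnn : 0 ≤ s * C / g.M * Real.exp (-(δ₂ * g.dist y y')) := by positivity
    exact (mul_le_mul_of_nonneg_right hii hnn).trans_eq (one_mul _)
  calc ∑ i ∈ D, ind S y * ind S y' * (s₁ / (g.M * g.len y ^ 2) * (C₁ * g.len y ^ 2 * Real.exp (-(δ₂ * g.dist y y')))) +
        ind S y * ind S y' * (s₂ / (g.M * g.len y ^ 2) * (CG * g.len y ^ 2 * Real.exp (-(δ₂ * g.dist y y'))))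
      ≤ ∑ i ∈ D, s₁ * C₁ / g.M * Real.exp (-(δ₂ * g.dist y y')) + s₂ * CG / g.M * Real.exp (-(δ₂ * g.dist y y')) :=
        add_le_add (Finset.sum_le_sum fun i _ => hle s₁ C₁ hs₁ hC₁) (hle s₂ CG hs₂ hCG)
    _ = (D.card * (s₁ * C₁) + s₂ * CG) / g.M * Real.exp (-(δ₂ * g.dist y y')) := by
        rw [Finset.sum_const, nsmul_eq_mul]
        field_simp

/-- **A COMMUTATOR LINE WITH THE PARTNER INPUT/OUTPUT-LOCALISED** (`commLine_hasMajorant_h` with `hasMajorant_comm_inout`): `N` with In- and Out-majorants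
`C_N(L^jη)^{−2}e^{−δ₂d}` over the set `T` carrying `supp h_□`. [cite: Balaban1984PropagatorsII, (2.134) p.247 + (2.92) p.239 + p.238] -/
theorem commLine_hasMajorant_inout (blk : X → g.Site) (hL : 1 ≤ g.L) (hη : 0 < g.eta) (hsep : LevelSep g)
    (hd : ∀ a b, 0 ≤ g.dist a b) {δ₂ CN CG c s r₀ : ℝ} (hδ₂ : 0 < δ₂) (hCN : 0 ≤ CN) (hCG : 0 ≤ CG)
    (hs : 0 ≤ s) (hr₀ : 0 ≤ r₀) (hM : 0 < g.M) (hRM : 0 ≤ g.R * g.M)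
    (hthr : g.L ^ 2 ≤ Real.exp (1 / 8 * δ₂ * (g.R * g.M))) (h263 : Ineq263With c g (3 / 4 * δ₂) (1 / 3))
    {N GH : Module.End ℝ (X → ℝ)} {z hc : X → ℝ} {T : Set g.Site}
    (hNin : InMajorant blk N T fun y y'' => CN / g.len y ^ 2 * Real.exp (-(δ₂ * g.dist y y'')))
    (hNout : ∀ (y'' : g.Site) (μ : X → ℝ) (B : ℝ), BlockSupp blk μ y'' B → ∀ x, blk x ∈ T →
      |N μ x| ≤ CN / g.len (blk x) ^ 2 * Real.exp (-(δ₂ * g.dist (blk x) y'')) * B)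
    (hz : ∀ x, |z x| ≤ 1) (hcT : ∀ x, hc x ≠ 0 → blk x ∈ T)
    (hLip : ∀ x x', |hc x' - hc x| ≤ s / g.M * (g.dist (blk x) (blk x') + r₀))
    (hGh : HasMajorant blk GH fun y'' y' => CG * g.len y'' ^ 2 * Real.exp (-(δ₂ * g.dist y'' y'))) :
    HasMajorant blk (mulOp z * (N * mulOp hc - mulOp hc * N) * GH) fun y y' =>
      s / g.M * (CN * CG * g.L ^ 2 * (8 / δ₂ + r₀)) * c ^ 2 * Real.exp (-(1 / 2 * δ₂ * g.dist y y')) := by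
  classical
  have hL0 : 0 < g.L := zero_lt_one.trans_le hL
  have hlen : ∀ z : g.Site, 0 < g.len z := fun z => mul_pos (pow_pos hL0 _) hη
  -- (1) the commutator with the block-Lipschitz h_□
  have hlipnn : ∀ y y'' : g.Site, 0 ≤ s / g.M * (g.dist y y'' + r₀) := fun y y'' => by
    have := hd y y''
    positivity
  have hKN : ∀ y y'' : g.Site, 0 ≤ CN / g.len y ^ 2 * Real.exp (-(δ₂ * g.dist y y'')) := fun y y'' => by
    have := hlen y
    positivity
  have hcomm := hasMajorant_comm_inout blk hKN hNin hNout hcT (lip := fun y y'' => s / g.M * (g.dist y y'' + r₀)) hlipnn hLip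
  -- (2) composition and the cut-off
  have hKG : ∀ a b : g.Site, 0 ≤ CG * g.len a ^ 2 * Real.exp (-(δ₂ * g.dist a b)) := fun a b => by positivity
  have hmul := hasMajorant_mul blk hcomm hGh hKG
  have hzT := hasMajorant_mulOp_left blk hmul hz
  rw [mul_assoc (mulOp z)]
  refine hasMajorant_mono blk hzT fun y y' => ?_
  -- (3) the pointwise bound
  have hterm : ∀ y'' : g.Site,
      s / g.M * (g.dist y y'' + r₀) * (CN / g.len y ^ 2 * Real.exp (-(δ₂ * g.dist y y''))) *
        (CG * g.len y'' ^ 2 * Real.exp (-(δ₂ * g.dist y'' y'))) ≤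
      s / g.M * (CN * CG * g.L ^ 2 * (8 / δ₂ + r₀)) *
        (Real.exp (-(3 / 4 * δ₂ * g.dist y y'')) * Real.exp (-(3 / 4 * δ₂ * g.dist y'' y'))) :=
    fun y'' => term_comm_le hL hη hsep hd hδ₂ hCN hCG hs hr₀ hM hRM hthr y y'' y'
  have hKnn : 0 ≤ s / g.M * (CN * CG * g.L ^ 2 * (8 / δ₂ + r₀)) := by positivity
  calc ∑ y'' : g.Site, s / g.M * (g.dist y y'' + r₀) * (CN / g.len y ^ 2 * Real.exp (-(δ₂ * g.dist y y''))) *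
          (CG * g.len y'' ^ 2 * Real.exp (-(δ₂ * g.dist y'' y')))
      ≤ ∑ y'' : g.Site, s / g.M * (CN * CG * g.L ^ 2 * (8 / δ₂ + r₀)) *
          (Real.exp (-(3 / 4 * δ₂ * g.dist y y'')) * Real.exp (-(3 / 4 * δ₂ * g.dist y'' y'))) :=
        Finset.sum_le_sum fun y'' _ => hterm y''
    _ = s / g.M * (CN * CG * g.L ^ 2 * (8 / δ₂ + r₀)) *
          ∑ y'' : g.Site, Real.exp (-(3 / 4 * δ₂ * g.dist y y'')) * Real.exp (-(3 / 4 * δ₂ * g.dist y'' y')) := by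
        rw [Finset.mul_sum]
    _ ≤ s / g.M * (CN * CG * g.L ^ 2 * (8 / δ₂ + r₀)) * (c ^ 2 * Real.exp (-(1 / 2 * δ₂ * g.dist y y'))) :=
        mul_le_mul_of_nonneg_left (sum_le h263 y y') hKnn
    _ = _ := by ring

/-- **(2.134), DIAGONAL PAIRS, ALL MEMBER OPERATORS LOCALISED OVER THE REACH** (the shape a member transplanted from a torus window satisfies): `G_□` with the
INPUT-localised majorant, the partners `N_k` with In- AND Out-localised majorants over `S`, the first-order pieces with the two-power split; everything else
and the conclusion as `diag_hasMajorant_in`. [cite: Balaban1984PropagatorsII, (2.134) p.247 + (2.133) p.247 + (2.92) p.239] -/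
theorem diag_hasMajorant_inout (blk : X → g.Site) (hL : 1 ≤ g.L) (hη : 0 < g.eta) (hsep : LevelSep g)
    (hd : ∀ a b, 0 ≤ g.dist a b) {δ₂ CG C₁ CN CD cD c s s₁ s₂ r₀ : ℝ} (hδ₂ : 0 < δ₂) (hCG : 0 ≤ CG)
    (hC₁ : 0 ≤ C₁) (hCN : 0 ≤ CN) (hCD : 0 ≤ CD) (hs : 0 ≤ s) (hs₁ : 0 ≤ s₁) (hs₂ : 0 ≤ s₂) (hr₀ : 0 ≤ r₀)
    (hM : 0 < g.M) (hRM : 0 ≤ g.R * g.M) (hthr : g.L ^ 2 ≤ Real.exp (1 / 8 * δ₂ * (g.R * g.M)))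
    (h263 : Ineq263With c g (3 / 4 * δ₂) (1 / 3))
    {Gl D₃ : Module.End ℝ (X → ℝ)} {hI c₀ : X → ℝ} {S : Set g.Site}
    {ι : Type} (D : Finset ι) {E : ι → Module.End ℝ (X → ℝ)} {cf : ι → X → ℝ}
    {κ : Type} (DK : Finset κ) {N : κ → Module.End ℝ (X → ℝ)} {z : κ → X → ℝ}
    (hGin : InMajorant blk Gl S fun y y' => CG * g.len y ^ 2 * Real.exp (-(δ₂ * g.dist y y')))
    (hEG : ∀ i ∈ D, LocalMajorant blk (E i * Gl) S fun y y' => C₁ * g.len y ^ 2 * Real.exp (-(δ₂ * g.dist y y')))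
    (hc : ∀ i ∈ D, ∀ x, |cf i x| ≤ s₁ / (g.M * g.len (blk x) ^ 2)) (hcS : ∀ i ∈ D, ∀ x, cf i x ≠ 0 → blk x ∈ S)
    (hc₀ : ∀ x, |c₀ x| ≤ s₂ / (g.M * g.len (blk x) ^ 2)) (hc₀S : ∀ x, c₀ x ≠ 0 → blk x ∈ S)
    (hI1 : ∀ x, |hI x| ≤ 1) (hIS : ∀ x, hI x ≠ 0 → blk x ∈ S)
    (hLip : ∀ x x', |hI x' - hI x| ≤ s / g.M * (g.dist (blk x) (blk x') + r₀))
    (hNin : ∀ k ∈ DK, InMajorant blk (N k) S fun y y'' => CN / g.len y ^ 2 * Real.exp (-(δ₂ * g.dist y y'')))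
    (hNout : ∀ k ∈ DK, ∀ (y'' : g.Site) (μ : X → ℝ) (B : ℝ), BlockSupp blk μ y'' B → ∀ x, blk x ∈ S →
      |N k μ x| ≤ CN / g.len (blk x) ^ 2 * Real.exp (-(δ₂ * g.dist (blk x) y'')) * B)
    (hz : ∀ k ∈ DK, ∀ x, |z k x| ≤ 1)
    (hD : HasMajorant blk D₃ fun y y'' => CD * Real.exp (-(cD * g.M)) / g.len y ^ 2 * Real.exp (-(δ₂ * g.dist y y''))) :
    HasMajorant blk
      (((∑ i ∈ D, mulOp (cf i) * E i - mulOp c₀) + (∑ k ∈ DK, mulOp (z k) * (N k * mulOp hI - mulOp hI * N k)) + D₃) *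
        (Gl * mulOp hI))
      fun y y' =>
        ((D.card * (s₁ * C₁) + s₂ * CG) / g.M + DK.card * (s / g.M * (CN * CG * g.L ^ 2 * (8 / δ₂ + r₀)) * c ^ 2) +
            CD * Real.exp (-(cD * g.M)) * CG * g.L ^ 2 * c ^ 2) *
          Real.exp (-(1 / 2 * δ₂ * g.dist y y')) := by
  classical
  have hL0 : 0 < g.L := zero_lt_one.trans_le hL
  -- `G_□h_□` globally, from the input-localised (2.133)
  have hKG : ∀ a b : g.Site, 0 ≤ CG * g.len a ^ 2 * Real.exp (-(δ₂ * g.dist a b)) := fun a b => by positivity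
  have hGh := hasMajorant_of_inMajorant blk hKG hGin hIS hI1
  rw [add_mul, add_mul, Finset.sum_mul]
  -- line 1 (two-power split, central outputs only)
  have h1 := line1_hasMajorant₂ blk hL0 hη hM (δ₂ := δ₂) hCG hC₁ hs₁ hs₂ D hGin.localMajorant hEG hc hcS hc₀ hc₀S hI1 hIS
  -- lines 2, 4
  have h2 := hasMajorant_finsetSum blk DK (fun k => mulOp (z k) * (N k * mulOp hI - mulOp hI * N k) * (Gl * mulOp hI))
    (fun _ y y' => s / g.M * (CN * CG * g.L ^ 2 * (8 / δ₂ + r₀)) * c ^ 2 * Real.exp (-(1 / 2 * δ₂ * g.dist y y')))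
    fun k hk => commLine_hasMajorant_inout blk hL hη hsep hd hδ₂ hCN hCG hs hr₀ hM hRM hthr h263 (hNin k hk) (hNout k hk) (hz k hk) hIS hLip hGh
  -- line 3
  have h3 := domLine_hasMajorant_h blk hL hη hsep hd hδ₂.le hCD hCG hRM hthr h263 hD hGh
  refine hasMajorant_mono blk (hasMajorant_add blk (hasMajorant_add blk h1 h2) h3) fun y y' => ?_
  -- pointwise: the rate δ₂ of line 1 is at least ½δ₂; the commutator lines add up
  have hθ₁ : 0 ≤ (D.card * (s₁ * C₁) + s₂ * CG) / g.M := by positivity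
  have hrate : Real.exp (-(δ₂ * g.dist y y')) ≤ Real.exp (-(1 / 2 * δ₂ * g.dist y y')) := by
    apply Real.exp_le_exp.mpr
    have := hd y y'
    nlinarith
  have hl1 : (D.card * (s₁ * C₁) + s₂ * CG) / g.M * Real.exp (-(δ₂ * g.dist y y')) ≤
      (D.card * (s₁ * C₁) + s₂ * CG) / g.M * Real.exp (-(1 / 2 * δ₂ * g.dist y y')) :=
    mul_le_mul_of_nonneg_left hrate hθ₁
  rw [Finset.sum_const, nsmul_eq_mul]
  nlinarith [hl1]

/-- **(2.134) for □ = □′ with all member operators localised over the reach, in the hypothesis shape of `…majorant_R_of_2134`** (`(Kt·G_□)·h_□`).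
[cite: Balaban1984PropagatorsII, (2.134) p.247, (2.133) p.247] -/
theorem diag_h2134_inout (blk : X → g.Site) (hL : 1 ≤ g.L) (hη : 0 < g.eta) (hsep : LevelSep g)
    (hd : ∀ a b, 0 ≤ g.dist a b) {δ₂ CG C₁ CN CD cD c s s₁ s₂ r₀ : ℝ} (hδ₂ : 0 < δ₂) (hCG : 0 ≤ CG)
    (hC₁ : 0 ≤ C₁) (hCN : 0 ≤ CN) (hCD : 0 ≤ CD) (hs : 0 ≤ s) (hs₁ : 0 ≤ s₁) (hs₂ : 0 ≤ s₂) (hr₀ : 0 ≤ r₀)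
    (hM : 0 < g.M) (hRM : 0 ≤ g.R * g.M) (hthr : g.L ^ 2 ≤ Real.exp (1 / 8 * δ₂ * (g.R * g.M)))
    (h263 : Ineq263With c g (3 / 4 * δ₂) (1 / 3))
    {Gl D₃ : Module.End ℝ (X → ℝ)} {hI c₀ : X → ℝ} {S : Set g.Site}
    {ι : Type} (D : Finset ι) {E : ι → Module.End ℝ (X → ℝ)} {cf : ι → X → ℝ}
    {κ : Type} (DK : Finset κ) {N : κ → Module.End ℝ (X → ℝ)} {z : κ → X → ℝ}
    (hGin : InMajorant blk Gl S fun y y' => CG * g.len y ^ 2 * Real.exp (-(δ₂ * g.dist y y')))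
    (hEG : ∀ i ∈ D, LocalMajorant blk (E i * Gl) S fun y y' => C₁ * g.len y ^ 2 * Real.exp (-(δ₂ * g.dist y y')))
    (hc : ∀ i ∈ D, ∀ x, |cf i x| ≤ s₁ / (g.M * g.len (blk x) ^ 2)) (hcS : ∀ i ∈ D, ∀ x, cf i x ≠ 0 → blk x ∈ S)
    (hc₀ : ∀ x, |c₀ x| ≤ s₂ / (g.M * g.len (blk x) ^ 2)) (hc₀S : ∀ x, c₀ x ≠ 0 → blk x ∈ S)
    (hI1 : ∀ x, |hI x| ≤ 1) (hIS : ∀ x, hI x ≠ 0 → blk x ∈ S)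
    (hLip : ∀ x x', |hI x' - hI x| ≤ s / g.M * (g.dist (blk x) (blk x') + r₀))
    (hNin : ∀ k ∈ DK, InMajorant blk (N k) S fun y y'' => CN / g.len y ^ 2 * Real.exp (-(δ₂ * g.dist y y'')))
    (hNout : ∀ k ∈ DK, ∀ (y'' : g.Site) (μ : X → ℝ) (B : ℝ), BlockSupp blk μ y'' B → ∀ x, blk x ∈ S →
      |N k μ x| ≤ CN / g.len (blk x) ^ 2 * Real.exp (-(δ₂ * g.dist (blk x) y'')) * B)
    (hz : ∀ k ∈ DK, ∀ x, |z k x| ≤ 1)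
    (hD : HasMajorant blk D₃ fun y y'' => CD * Real.exp (-(cD * g.M)) / g.len y ^ 2 * Real.exp (-(δ₂ * g.dist y y''))) :
    HasMajorant blk
      (((∑ i ∈ D, mulOp (cf i) * E i - mulOp c₀) + (∑ k ∈ DK, mulOp (z k) * (N k * mulOp hI - mulOp hI * N k)) + D₃) *
          Gl * mulOp hI)
      fun y y' =>
        ((D.card * (s₁ * C₁) + s₂ * CG) / g.M + DK.card * (s / g.M * (CN * CG * g.L ^ 2 * (8 / δ₂ + r₀)) * c ^ 2) +
            CD * Real.exp (-(cD * g.M)) * CG * g.L ^ 2 * c ^ 2) *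
          Real.exp (-(1 / 2 * δ₂ * g.dist y y')) := by
  rw [mul_assoc]
  exact diag_hasMajorant_inout blk hL hη hsep hd hδ₂ hCG hC₁ hCN hCD hs hs₁ hs₂ hr₀ hM hRM hthr h263 D DK hGin hEG hc hcS
    hc₀ hc₀S hI1 hIS hLip hNin hNout hz hD

end InOut

end Literature.MathematicalPhysics.QuantumFieldTheory.Balaban1983to89.B6Ineq2134DiagIn
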